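import Summits.Ventures.Crystal3D.Theorems.StickyWulffConstantTextureLiminfCellFluxSel
import Summits.Ventures.Crystal3D.Theorems.StickyWulffConstantTextureLiminfBilayerWallBookkeeping
import HarnessLib

/-!
# The covered wall cell inequality from a LINE COUNT (by-name glue: F4's deliverable ⇒ `BilayerWallAt`)
# (lane T, the T-side port of lane G's walker ledger; crux `TextureLiminf`, stmt-Ventures-19483)

HONEST FRAMING. Venture `Summits/Ventures/Crystal3D` (cell `crystal3d-full`), helper `--supports` the crux
`TextureLiminf` (stmt-Ventures-19483) of `route-Ventures-StickyWulffConstant`, registered line `TexShadow` (v6.7, stub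
`stub_bilayerWallCovered`; cf-p1 ROUTE.md §86(58) BA / §86(61) BD).  Rung credit only; F-C1 not moved.  NOT the wall law.

The last T-side link of the covered-wall chain.  Lane G's F4 (19480-p2, CAP-START walker families on Barlow plates,
`walkerFamilies_card_le_payers` + sealing + orbit-freeness) delivers, cell by cell, finite index sets `T₁, T₂` of the walk
machine's zigzag lines (selectors `step₁`, `step₂`) launched from the inner discs of the two plate windows, with
`#T₁ + #T₂ + 18·m·ρ ≤ Σ_{y ∈ PAY} (12 − deg y) + C_w (1+h) ρ`.  This file turns exactly that statement into the cell
inequality: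

* **`bilayerWallAt_of_lineCount`** — for every flux-dominated table `c ≥ 0` (`FluxDominated τ₀ L₁ σ₁ L₂ σ₂ c`), the F4-shaped
  hypothesis `hF4` implies `BilayerWallAt ((C_w + 80(R₀+9) + 3456 + 1152(R₀+1))/2) R₀ σ₁ σ₂ L₁ L₂ s₁ s₂ c` (`R₀ ≥ 3`):
  `cell_charge_le_lines_margin_sel` (`…CellFluxSel`) feeds `bilayerWallAt_of_payerBound` (`…BilayerWallBookkeeping`).
So `stub_bilayerWallCovered` (v6.7) closes, for explicit constants, the moment F4 discharges `hF4` for the machine's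
selectors (modulo lane G's E1 input of `walkerFamilies_card_le_payers`).
WHAT THIS IS NOT: not F4, not the stub; F-C1 not moved.
-/

noncomputable section

namespace Summit.Ventures.Crystal3D.Theorems

open MeasureTheory Set
open scoped ENNReal InnerProductSpace
open Literature.MathematicalPhysics.StatisticalMechanics (IsHaggSeq triangularVec₁ triangularVec₂)
open Summit.Ventures.Crystal3D.Cruxes.TextureLiminf.TexShadow (E3 e₃ cyl stacking laySlab BilayerWallAt FluxDominated)

/-- **F4's deliverable ⇒ the covered cell inequality.**  See the module docstring. -/
theorem bilayerWallAt_of_lineCount {σ₁ σ₂ : ℤ → ℤ} (hσ₁ : IsHaggSeq σ₁) (hσ₂ : IsHaggSeq σ₂)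
    (L₁ L₂ : E3 ≃ₗᵢ[ℝ] E3) (s₁ s₂ : E3) (τ₀ R₀ C_w : ℝ) (hR₀ : 3 ≤ R₀)
    (c : ℤ → ℤ → ℝ) (hc0 : ∀ i j, 0 ≤ c i j) (hdom : FluxDominated τ₀ L₁ σ₁ L₂ σ₂ c)
    {step₁ : ℤ → E3} (hsel₁ : IsZigSelector L₁ σ₁ e₃ step₁) {step₂ : ℤ → E3} (hsel₂ : IsZigSelector L₂ σ₂ (-e₃) step₂)
    (hF4 : ∀ h : ℝ, 0 ≤ h → ∀ ρ : ℝ, R₀ ≤ ρ → ∀ X P₁ P₂ : Finset E3,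
      (∀ p ∈ X, ∀ q ∈ X, p ≠ q → 1 ≤ dist p q) → P₁ ⊆ X → P₂ ⊆ X \ P₁ → (∀ p ∈ X, p ∈ cyl R₀ h ρ) →
      (∀ p, p ∈ P₁ ↔ (p ∈ stacking L₁ s₁ σ₁ ∧ -(2 * R₀) ≤ p 2 ∧ p 2 ≤ -R₀ ∧ p 0 ^ 2 + p 1 ^ 2 ≤ ρ ^ 2)) →
      (∀ p, p ∈ P₂ ↔ (p ∈ stacking L₂ s₂ σ₂ ∧ h + R₀ ≤ p 2 ∧ p 2 ≤ h + 2 * R₀ ∧ p 0 ^ 2 + p 1 ^ 2 ≤ ρ ^ 2)) →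
      ∃ (m : ℝ) (T₁ T₂ : Finset (Fin 2 → ℤ)), 0 ≤ m ∧
        (∀ t : Fin 2 → ℤ, (∃ k : ℤ,
          -R₀ - 4 ≤ (L₁ (zigVertexS step₁ k + ((t 0 : ℝ) • triangularVec₁ 1 + (t 1 : ℝ) • triangularVec₂ 1)) + s₁) 2 ∧
          (L₁ (zigVertexS step₁ k + ((t 0 : ℝ) • triangularVec₁ 1 + (t 1 : ℝ) • triangularVec₂ 1)) + s₁) 2 ≤ -R₀ - 3 ∧
          Real.sqrt ((L₁ (zigVertexS step₁ k + ((t 0 : ℝ) • triangularVec₁ 1 + (t 1 : ℝ) • triangularVec₂ 1)) + s₁) 0 ^ 2 +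
            (L₁ (zigVertexS step₁ k + ((t 0 : ℝ) • triangularVec₁ 1 + (t 1 : ℝ) • triangularVec₂ 1)) + s₁) 1 ^ 2) ≤ ρ - m) →
          t ∈ T₁) ∧
        (∀ t : Fin 2 → ℤ, (∃ k : ℤ,
          h + R₀ + 3 ≤ (L₂ (zigVertexS step₂ k + ((t 0 : ℝ) • triangularVec₁ 1 + (t 1 : ℝ) • triangularVec₂ 1)) + s₂) 2 ∧
          (L₂ (zigVertexS step₂ k + ((t 0 : ℝ) • triangularVec₁ 1 + (t 1 : ℝ) • triangularVec₂ 1)) + s₂) 2 ≤ h + R₀ + 4 ∧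
          Real.sqrt ((L₂ (zigVertexS step₂ k + ((t 0 : ℝ) • triangularVec₁ 1 + (t 1 : ℝ) • triangularVec₂ 1)) + s₂) 0 ^ 2 +
            (L₂ (zigVertexS step₂ k + ((t 0 : ℝ) • triangularVec₁ 1 + (t 1 : ℝ) • triangularVec₂ 1)) + s₂) 1 ^ 2) ≤ ρ - m) →
          t ∈ T₂) ∧
        (T₁.card : ℝ) + T₂.card + 18 * m * ρ ≤
          (∑ y ∈ X.filter (fun y => (X.filter fun q => dist y q = 1).card ≠ 12 ∧ -R₀ - 2 ≤ y 2 ∧ y 2 ≤ h + R₀ + 2),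
            ((12 : ℝ) - ((X.filter fun q => dist y q = 1).card : ℝ))) + C_w * (1 + h) * ρ) :
    BilayerWallAt ((C_w + 80 * (R₀ + 9) + 3456 + 1152 * (R₀ + 1)) / 2) R₀ σ₁ σ₂ L₁ L₂ s₁ s₂ c := by
  classical
  have hR₀1 : 1 ≤ R₀ := by linarith
  refine bilayerWallAt_of_payerBound hσ₁ hσ₂ L₁ L₂ s₁ s₂ R₀ (C_w + 80 * (R₀ + 9)) hR₀ c ?_
  intro h hh ρ hρ X P₁ P₂ hX hP₁X hP₂X hcell hP₁ hP₂
  obtain ⟨m, T₁, T₂, hm, hT₁, hT₂, hcount⟩ := hF4 h hh ρ hρ X P₁ P₂ hX hP₁X hP₂X hcell hP₁ hP₂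
  have hρ0 : 0 ≤ ρ := by linarith
  have hcellbound := cell_charge_le_lines_margin_sel hσ₁ hσ₂ L₁ L₂ s₁ s₂ τ₀ R₀ h ρ hR₀1 hh hρ0 c hc0 hdom hsel₁ hsel₂
    m hm T₁ T₂ hT₁ hT₂
  have hset : ({q : E3 | 0 ≤ q 2 ∧ q 2 ≤ 1 ∧ q 0 ^ 2 + q 1 ^ 2 ≤ ρ ^ 2} : Set E3) = wallSlice ρ := rfl
  rw [hset]
  have hsplit : (C_w + 80 * (R₀ + 9)) * (1 + h) * ρ = C_w * (1 + h) * ρ + 80 * (R₀ + 9) * (1 + h) * ρ := by ring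
  rw [hsplit]
  linarith

end Summit.Ventures.Crystal3D.Theorems

end
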